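import Literature.GroupTheory.CombinatorialGroupTheory.NielsenGeneratingTuplesNormalForm
import HarnessLib

/-!
# Re-basing a free splitting along a complementary free factor

Topic `Literature/GroupTheory/CombinatorialGroupTheory`.  Let `F = F(ι)` be free on a finite
set `ι` coloured by `c : ι → Fin 3`, `ι = X ⊔ Y ⊔ T` (`X = c⁻¹(0)`, `Y = c⁻¹(1)`, `T = c⁻¹(2)`),
and put `U = ⟪Y ∪ T⟫` (so `F ⧸ U = F(X)`), `B = ⟨X ∪ T⟩` (a free factor), `V = ⟪X ∪ T⟫ = ⟪B⟫`.
**Re-basing lemma** (`exists_mulEquiv_map_normalClosure_eq`): if `θ₀ ∈ Aut F` and the free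
factor `A = θ₀(B)` satisfies `A ⊔ U = ⊤` (i.e. `A` maps ONTO `F ⧸ U = F(X)`), then there is
`θ ∈ Aut F` with `θ(U) = U` and `θ(V) = θ₀(V)`.

Proof.  `φ : F → F(X)` kills `Y ∪ T`, `ker φ = U` (`ker_lift_dite`).  The tuple
`(φ θ₀ z)_{z ∈ X ∪ T}` generates `F(X)`, so by the normal form of generating tuples under Nielsen
transformations (`exists_mulAut_lift_apply_eq_basis`, Lyndon–Schupp I Prop. 2.7) there is
`ε ∈ Aut F(X ∪ T)` with `φ θ₀ ε(x) = x` (`x ∈ X`) and `φ θ₀ ε(t) = 1` (`t ∈ T`).  Extend `ε` by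
the identity on `Y` to `E ∈ Aut F` (`exists_mulAut_extend`) and put `Θ = θ₀ ∘ E`, so
`a_z = Θ(z)` (`z ∈ X ∪ T`) is a new basis of `A` with `φ(a_x) = x`, `φ(a_t) = 1`, and
`s : x ↦ a_x` is a section of `φ`.  Correct the complement by the transvection
`D : y ↦ y · Θ⁻¹(s φ θ₀ y)⁻¹` (`y ∈ Y`; the correction lies in `B`, so `D ∈ Aut F`,
`exists_mulAut_transvection`) and put `θ = Θ ∘ D`.  Then `φ ∘ θ = φ` on every generator, whence
`θ⁻¹(U) = ker (φ ∘ θ) = ker φ = U`; and `D`, `E` preserve `B`, whence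
`θ(V) = θ₀(⟪B⟫) = θ₀(V)`.  (This is the algebraic core of "an epimorphism `F_{2k} ↠ F_k` whose
restriction to a complementary free factor is onto is standard", as used for T-systems of
Heegaard splittings and trisections.)

Also here, reusable: `ker_lift_dite` (killing part of a basis: the kernel is the normal
closure of the killed letters), `exists_mulAut_extend` (extending an automorphism of a free
factor `F(p)` by the identity), `exists_mulAut_transvection` (`xᵢ ↦ xᵢ dᵢ`, `dᵢ ∈ ⟨p⟩`,
`i ∉ p`, is an automorphism).

## References

* R. C. Lyndon, P. E. Schupp, *Combinatorial Group Theory*, Springer (1977); Classics in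
  Mathematics (2001), Ch. I §2, Prop. 2.7 (and Prop. 2.12). [LyndonSchupp2001]
* J. Nielsen, *Die Isomorphismengruppe der freien Gruppen*, Math. Ann. 91 (1924). [Nielsen1924]
-/

namespace Literature.GroupTheory.CombinatorialGroupTheory

/-! ### Killing part of a basis -/

section Proj

variable {ι : Type*} (p : ι → Prop) [DecidablePred p]

/-- The projection `F(ι) → F(p)` killing the basis elements outside `p` is split by the
inclusion, hence onto. [folklore] -/
theorem lift_dite_map_val (y : FreeGroup {i // p i}) :
    FreeGroup.lift (fun i => if h : p i then FreeGroup.of (⟨i, h⟩ : {i // p i}) else 1)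
      (FreeGroup.map Subtype.val y) = y := by
  have : (FreeGroup.lift fun i => if h : p i then FreeGroup.of (⟨i, h⟩ : {i // p i}) else 1).comp
      (FreeGroup.map Subtype.val) = MonoidHom.id _ :=
    FreeGroup.ext_hom _ _ fun j => by simp [FreeGroup.map.of, j.2]
  exact DFunLike.congr_fun this y

/-- The projection killing part of a basis is onto. [folklore] -/
theorem lift_dite_surjective : Function.Surjective
    (FreeGroup.lift fun i => if h : p i then FreeGroup.of (⟨i, h⟩ : {i // p i}) else 1) :=
  fun y => ⟨FreeGroup.map Subtype.val y, lift_dite_map_val p y⟩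

/-- **The kernel of the projection `F(ι) → F(p)` killing the basis elements outside `p` is the
normal closure of the killed basis elements** (`F(ι) ⧸ ⟪ι ∖ p⟫ = F(p)`). [folklore] -/
theorem ker_lift_dite :
    (FreeGroup.lift fun i => if h : p i then FreeGroup.of (⟨i, h⟩ : {i // p i}) else 1).ker =
      Subgroup.normalClosure (FreeGroup.of '' {i | ¬ p i}) := by
  set π := FreeGroup.lift fun i => if h : p i then FreeGroup.of (⟨i, h⟩ : {i // p i}) else 1
    with hπ
  have hπ_pos : ∀ i (h : p i), π (FreeGroup.of i) = FreeGroup.of ⟨i, h⟩ := fun i h => by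
    rw [hπ, FreeGroup.lift_apply_of, dif_pos h]
  have hπ_neg : ∀ i, ¬ p i → π (FreeGroup.of i) = 1 := fun i h => by
    rw [hπ, FreeGroup.lift_apply_of, dif_neg h]
  apply le_antisymm
  · intro x hx
    set K := Subgroup.normalClosure (FreeGroup.of '' {i | ¬ p i}) with hK
    set ψ : FreeGroup {i // p i} →* FreeGroup ι ⧸ K :=
      FreeGroup.lift fun j => (QuotientGroup.mk (FreeGroup.of j.1) : FreeGroup ι ⧸ K) with hψ
    have hcomp : ψ.comp π = QuotientGroup.mk' K := by
      apply FreeGroup.ext_hom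
      intro i
      by_cases hi : p i
      · rw [MonoidHom.comp_apply, hπ_pos i hi, hψ, FreeGroup.lift_apply_of,
          QuotientGroup.mk'_apply]
      · rw [MonoidHom.comp_apply, hπ_neg i hi, map_one, QuotientGroup.mk'_apply, eq_comm,
          QuotientGroup.eq_one_iff]
        exact Subgroup.subset_normalClosure ⟨i, hi, rfl⟩
    rw [MonoidHom.mem_ker] at hx
    have := DFunLike.congr_fun hcomp x
    rw [MonoidHom.comp_apply, hx, map_one, QuotientGroup.mk'_apply, eq_comm,
      QuotientGroup.eq_one_iff] at this
    exact this
  · refine Subgroup.normalClosure_le_normal ?_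
    rintro _ ⟨i, hi, rfl⟩
    rw [SetLike.mem_coe, MonoidHom.mem_ker, hπ_neg i hi]

end Proj

/-! ### Extending an automorphism of a free factor; transvections -/

section Extend

variable {ι : Type*} (p : ι → Prop) [DecidablePred p]

/-- **Extension of an automorphism of the free factor `F(p)` by the identity**: for every
automorphism `ε` of `F(p)` there is an automorphism of `F(ι)` acting by `ε` on `F(p)` and
fixing the basis elements outside `p`. [folklore] -/
theorem exists_mulAut_extend (ε : MulAut (FreeGroup {i // p i})) :
    ∃ E : MulAut (FreeGroup ι),
      (∀ y, E (FreeGroup.map Subtype.val y) = FreeGroup.map Subtype.val (ε y)) ∧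
      (∀ i, ¬ p i → E (FreeGroup.of i) = FreeGroup.of i) := by
  -- `X η`: act by `η` on the factor, by the identity elsewhere
  set X : MulAut (FreeGroup {i // p i}) → (FreeGroup ι →* FreeGroup ι) := fun η =>
    FreeGroup.lift fun i =>
      if h : p i then FreeGroup.map Subtype.val (η (FreeGroup.of ⟨i, h⟩)) else FreeGroup.of i
    with hX
  have hXpos : ∀ η i (h : p i),
      X η (FreeGroup.of i) = FreeGroup.map Subtype.val (η (FreeGroup.of ⟨i, h⟩)) :=
    fun η i h => by rw [hX, FreeGroup.lift_apply_of, dif_pos h]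
  have hXneg : ∀ η i, ¬ p i → X η (FreeGroup.of i) = FreeGroup.of i :=
    fun η i h => by rw [hX, FreeGroup.lift_apply_of, dif_neg h]
  have hXmap : ∀ η y, X η (FreeGroup.map Subtype.val y) = FreeGroup.map Subtype.val (η y) := by
    intro η y
    have : (X η).comp (FreeGroup.map Subtype.val) =
        (FreeGroup.map Subtype.val).comp η.toMonoidHom :=
      FreeGroup.ext_hom _ _ fun j => by
        rw [MonoidHom.comp_apply, FreeGroup.map.of, hXpos η _ j.2]; rfl
    exact DFunLike.congr_fun this y
  have hXmul : ∀ η η', X (η * η') = (X η).comp (X η') := fun η η' =>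
    FreeGroup.ext_hom _ _ fun i => by
      by_cases h : p i
      · rw [MonoidHom.comp_apply, hXpos _ _ h, hXpos _ _ h, hXmap, MulAut.mul_apply]
      · rw [MonoidHom.comp_apply, hXneg _ _ h, hXneg _ _ h, hXneg _ _ h]
  have hX1 : X 1 = MonoidHom.id _ := FreeGroup.ext_hom _ _ fun i => by
    by_cases h : p i
    · rw [hXpos _ _ h, MulAut.one_apply, FreeGroup.map.of]; rfl
    · rw [hXneg _ _ h]; rfl
  refine ⟨(X ε).toMulEquiv (X ε⁻¹) (by rw [← hXmul, inv_mul_cancel, hX1])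
    (by rw [← hXmul, mul_inv_cancel, hX1]), fun y => hXmap ε y, fun i hi => hXneg ε i hi⟩

/-- **Transvections are automorphisms**: if every `dᵢ` (`i ∉ p`) lies in `⟨p⟩`, then there is
an automorphism of `F(ι)` with `xᵢ ↦ xᵢ` (`i ∈ p`) and `xᵢ ↦ xᵢ dᵢ` (`i ∉ p`) (its inverse is
`xᵢ ↦ xᵢ dᵢ⁻¹`). [folklore] -/
theorem exists_mulAut_transvection (d : ι → FreeGroup ι)
    (hd : ∀ i, ¬ p i → d i ∈ Subgroup.closure (FreeGroup.of '' {i | p i})) :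
    ∃ D : MulAut (FreeGroup ι),
      (∀ i, p i → D (FreeGroup.of i) = FreeGroup.of i) ∧
      (∀ i, ¬ p i → D (FreeGroup.of i) = FreeGroup.of i * d i) := by
  set X : (ι → FreeGroup ι) → (FreeGroup ι →* FreeGroup ι) := fun d' =>
    FreeGroup.lift fun i => if p i then FreeGroup.of i else FreeGroup.of i * d' i with hX
  have hXpos : ∀ d' i, p i → X d' (FreeGroup.of i) = FreeGroup.of i := fun d' i h => by
    rw [hX, FreeGroup.lift_apply_of, if_pos h]
  have hXneg : ∀ d' i, ¬ p i → X d' (FreeGroup.of i) = FreeGroup.of i * d' i := fun d' i h => by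
    rw [hX, FreeGroup.lift_apply_of, if_neg h]
  have hXfix : ∀ d' {y : FreeGroup ι}, y ∈ Subgroup.closure (FreeGroup.of '' {i | p i}) →
      X d' y = y := by
    intro d' y hy
    refine (Subgroup.closure_le ((X d').eqLocus (MonoidHom.id _))).2 ?_ hy
    rintro _ ⟨i, hi, rfl⟩
    exact hXpos d' i hi
  refine ⟨(X d).toMulEquiv (X fun i => (d i)⁻¹) ?_ ?_, fun i hi => hXpos d i hi,
    fun i hi => hXneg d i hi⟩
  · refine FreeGroup.ext_hom _ _ fun i => ?_
    by_cases h : p i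
    · rw [MonoidHom.comp_apply, hXpos _ _ h, hXpos _ _ h]; rfl
    · rw [MonoidHom.comp_apply, hXneg _ _ h, map_mul, hXneg _ _ h, hXfix _ (hd i h),
        inv_mul_cancel_right]; rfl
  · refine FreeGroup.ext_hom _ _ fun i => ?_
    by_cases h : p i
    · rw [MonoidHom.comp_apply, hXpos _ _ h, hXpos _ _ h]; rfl
    · rw [MonoidHom.comp_apply, hXneg _ _ h, map_mul, map_inv, hXneg _ _ h, hXfix _ (hd i h),
        mul_inv_cancel_right]; rfl

end Extend

/-! ### The re-basing lemma -/

section Rebasing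

/-- Transport of a subgroup along a composite of isomorphisms. [folklore] -/
theorem map_trans_toMonoidHom {G : Type*} [Group G] (e₁ e₂ : G ≃* G) (H : Subgroup G) :
    H.map (e₁.trans e₂).toMonoidHom = (H.map e₁.toMonoidHom).map e₂.toMonoidHom := by
  rw [Subgroup.map_map]
  rfl

/-- **Re-basing lemma.** `F = F(ι)`, `ι` finite, coloured by `c : ι → Fin 3`; `U = ⟪c ≠ 0⟫`,
`B = ⟨c ≠ 1⟩`, `V = ⟪c ≠ 1⟫`.  If `θ₀ ∈ Aut F` satisfies `θ₀(B) ⊔ U = ⊤`, then some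
`θ ∈ Aut F` has `θ(U) = U` and `θ(V) = θ₀(V)`.  See the module docstring for the proof
(Nielsen normal form of the generating tuple `(θ₀ z mod U)_{c z ≠ 1}` of `F ⧸ U = F(c = 0)`,
Lyndon–Schupp I Prop. 2.7, then a transvection of the complement).
[cite: LyndonSchupp2001, Ch. I Prop. 2.7] -/
theorem exists_mulEquiv_map_normalClosure_eq {ι : Type*} [Finite ι] (c : ι → Fin 3)
    (θ₀ : FreeGroup ι ≃* FreeGroup ι)
    (hT : (Subgroup.closure (FreeGroup.of '' {i | c i ≠ 1})).map θ₀.toMonoidHom ⊔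
      Subgroup.normalClosure (FreeGroup.of '' {i | c i ≠ 0}) = ⊤) :
    ∃ θ : FreeGroup ι ≃* FreeGroup ι,
      (Subgroup.normalClosure (FreeGroup.of '' {i | c i ≠ 0})).map θ.toMonoidHom =
        Subgroup.normalClosure (FreeGroup.of '' {i | c i ≠ 0}) ∧
      (Subgroup.normalClosure (FreeGroup.of '' {i | c i ≠ 1})).map θ.toMonoidHom =
        (Subgroup.normalClosure (FreeGroup.of '' {i | c i ≠ 1})).map θ₀.toMonoidHom := by
  classical
  set U := Subgroup.normalClosure (FreeGroup.of '' {i | c i ≠ 0}) with hU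
  set B := Subgroup.closure (FreeGroup.of '' {i | c i ≠ 1}) with hB
  -- `φ : F → F(X)`, `ker φ = U`
  set φ : FreeGroup ι →* FreeGroup {i // c i = 0} :=
    FreeGroup.lift fun i => if h : c i = 0 then FreeGroup.of (⟨i, h⟩ : {i // c i = 0}) else 1
    with hφ
  have hUker : φ.ker = U := ker_lift_dite (fun i => c i = 0)
  have hφsurj : Function.Surjective φ := lift_dite_surjective (fun i => c i = 0)
  have hφ0 : ∀ i (hi : c i = 0), φ (FreeGroup.of i) = FreeGroup.of ⟨i, hi⟩ := fun i hi => by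
    rw [hφ, FreeGroup.lift_apply_of, dif_pos hi]
  have hφ0' : ∀ i, c i ≠ 0 → φ (FreeGroup.of i) = 1 := fun i hi => by
    rw [hφ, FreeGroup.lift_apply_of, dif_neg hi]
  -- `B` is the image of `F(X ∪ T)`
  have hBrange : (FreeGroup.map (Subtype.val : {i // c i ≠ 1} → ι)).range = B := by
    rw [FreeGroup.range_map, Subtype.range_coe_subtype]
  -- the generating tuple of `F(X)`
  set u : {i // c i ≠ 1} → FreeGroup {i // c i = 0} := fun z => φ (θ₀ (FreeGroup.of z.1))
    with hu
  have hlift : FreeGroup.lift u =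
      φ.comp (θ₀.toMonoidHom.comp (FreeGroup.map (Subtype.val : {i // c i ≠ 1} → ι))) :=
    FreeGroup.ext_hom _ _ fun z => by simp [hu, FreeGroup.map.of]
  have hgen : Subgroup.closure (Set.range u) = ⊤ := by
    rw [← FreeGroup.range_lift_eq_closure, hlift, MonoidHom.range_comp, MonoidHom.range_comp,
      hBrange]
    have h := congrArg (Subgroup.map φ) hT
    rw [Subgroup.map_sup, (Subgroup.map_eq_bot_iff U).2 (le_of_eq hUker.symm), sup_bot_eq,
      ← MonoidHom.range_eq_map, MonoidHom.range_eq_top.2 hφsurj] at h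
    exact h
  -- Nielsen normal form of the tuple
  set e : {i // c i = 0} → {i // c i ≠ 1} := fun x => ⟨x.1, ne_of_eq_of_ne x.2 (by decide)⟩
    with he_def
  have he : Function.Injective e := fun x y h => by
    have h' := congrArg Subtype.val h
    exact Subtype.ext h'
  obtain ⟨ε, hε₁, hε₂⟩ := exists_mulAut_lift_apply_eq_basis u hgen e he
  have hlift' : ∀ y, FreeGroup.lift u y = φ (θ₀ (FreeGroup.map Subtype.val y)) := fun y => by
    rw [hlift]; rfl
  -- extend `ε` by the identity on `Y`, and compose with `θ₀`
  obtain ⟨E, hE₁, hE₂⟩ := exists_mulAut_extend (fun i => c i ≠ 1) ε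
  set Θ := E.trans θ₀ with hΘ
  have hΘof : ∀ z : {i // c i ≠ 1},
      Θ (FreeGroup.of z.1) = θ₀ (FreeGroup.map Subtype.val (ε (FreeGroup.of z))) := by
    intro z
    rw [hΘ, MulEquiv.trans_apply, ← hE₁, FreeGroup.map.of]
  have hΘ0 : ∀ i (hi : c i = 0), φ (Θ (FreeGroup.of i)) = FreeGroup.of ⟨i, hi⟩ := by
    intro i hi
    rw [← hε₁ ⟨i, hi⟩, hlift', ← hΘof]
  have hΘ2 : ∀ i, c i = 2 → φ (Θ (FreeGroup.of i)) = 1 := by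
    intro i hi
    have hi1 : c i ≠ 1 := by rw [hi]; decide
    have h2 : (⟨i, hi1⟩ : {i // c i ≠ 1}) ∉ Set.range e := by
      rintro ⟨x, hx⟩
      have hx' : x.1 = i := congrArg Subtype.val hx
      have h0 := x.2
      rw [hx', hi] at h0
      exact absurd h0 (by decide)
    rw [← hε₂ _ h2, hlift', ← hΘof]
  -- the section `s : F(X) → F` of `φ`, `x ↦ a_x`
  set s : FreeGroup {i // c i = 0} →* FreeGroup ι :=
    FreeGroup.lift fun x => Θ (FreeGroup.of x.1) with hs
  have hφs : ∀ y, φ (s y) = y := by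
    intro y
    have : φ.comp s = MonoidHom.id _ := FreeGroup.ext_hom _ _ fun x => by
      rw [MonoidHom.comp_apply, hs, FreeGroup.lift_apply_of, hΘ0 x.1 x.2]; rfl
    exact DFunLike.congr_fun this y
  have hsB : ∀ y, Θ.symm (s y) ∈ B := by
    intro y
    have hle : s.range ≤ B.map Θ.toMonoidHom := by
      rw [hs, FreeGroup.range_lift_eq_closure, Subgroup.closure_le]
      rintro _ ⟨x, rfl⟩
      exact ⟨FreeGroup.of x.1,
        Subgroup.subset_closure ⟨x.1, ne_of_eq_of_ne x.2 (by decide), rfl⟩, rfl⟩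
    obtain ⟨b, hb, hb'⟩ := hle ⟨y, rfl⟩
    rw [← hb', MulEquiv.coe_toMonoidHom, MulEquiv.symm_apply_apply]
    exact hb
  -- the transvection correcting the complement into `U`
  set d : ι → FreeGroup ι := fun i => (Θ.symm (s (φ (θ₀ (FreeGroup.of i)))))⁻¹ with hd
  have hdB : ∀ i, ¬ (c i ≠ 1) → d i ∈ Subgroup.closure (FreeGroup.of '' {i | c i ≠ 1}) :=
    fun i _ => inv_mem (hsB _)
  obtain ⟨D, hD₁, hD₂⟩ := exists_mulAut_transvection (fun i => c i ≠ 1) d hdB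
  have hDfix : Set.EqOn D.toMonoidHom (MonoidHom.id _) (B : Set (FreeGroup ι)) := by
    rw [hB]
    refine MonoidHom.eqOn_closure ?_
    rintro _ ⟨i, hi, rfl⟩
    exact hD₁ i hi
  -- `θ = Θ ∘ D` satisfies `φ ∘ θ = φ`
  have hφθ : φ.comp (D.trans Θ).toMonoidHom = φ := by
    apply FreeGroup.ext_hom
    intro i
    rw [MonoidHom.comp_apply, MulEquiv.coe_toMonoidHom, MulEquiv.trans_apply]
    have hc : ∀ t : Fin 3, t = 0 ∨ t = 1 ∨ t = 2 := by decide
    rcases hc (c i) with h0 | h1 | h2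
    · rw [hD₁ i (ne_of_eq_of_ne h0 (by decide)), hΘ0 i h0, hφ0 i h0]
    · rw [hD₂ i (by simpa using h1), map_mul, hd, map_inv, MulEquiv.apply_symm_apply, map_mul,
        map_inv, hφs, hφ0' i (ne_of_eq_of_ne h1 (by decide)), hΘ, MulEquiv.trans_apply,
        hE₂ i (by simpa using h1), mul_inv_cancel]
    · rw [hD₁ i (ne_of_eq_of_ne h2 (by decide)), hΘ2 i h2,
        hφ0' i (ne_of_eq_of_ne h2 (by decide))]
  refine ⟨D.trans Θ, ?_, ?_⟩
  · -- `θ(U) = U`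
    rw [← hUker]
    have hcomap : φ.ker.comap (D.trans Θ).toMonoidHom = φ.ker := by
      rw [MonoidHom.comap_ker, hφθ]
    conv_lhs => rw [← hcomap]
    exact Subgroup.map_comap_eq_self_of_surjective (D.trans Θ).surjective _
  · -- `θ(V) = θ₀(V)`
    have hV : Subgroup.normalClosure (FreeGroup.of '' {i | c i ≠ 1}) =
        Subgroup.normalClosure (B : Set (FreeGroup ι)) := by
      rw [hB, Subgroup.normalClosure_closure_eq_normalClosure]
    have hDB : ((D.trans Θ).toMonoidHom : FreeGroup ι → FreeGroup ι) '' (B : Set (FreeGroup ι)) =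
        θ₀.toMonoidHom '' (E.toMonoidHom '' (B : Set (FreeGroup ι))) := by
      rw [Set.image_image]
      refine Set.image_congr fun y hy => ?_
      have := hDfix hy
      simp only [MulEquiv.coe_toMonoidHom, MonoidHom.id_apply] at this
      simp only [MulEquiv.coe_toMonoidHom, MulEquiv.trans_apply, this, hΘ]
    have hEB : (E.toMonoidHom : FreeGroup ι → FreeGroup ι) '' (B : Set (FreeGroup ι)) = B := by
      rw [← Subgroup.coe_map]
      congr 1
      have hcomp : E.toMonoidHom.comp (FreeGroup.map (Subtype.val : {i // c i ≠ 1} → ι)) =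
          (FreeGroup.map Subtype.val).comp ε.toMonoidHom :=
        FreeGroup.ext_hom _ _ fun z => by
          rw [MonoidHom.comp_apply, MonoidHom.comp_apply, MulEquiv.coe_toMonoidHom,
            MulEquiv.coe_toMonoidHom, hE₁]
      rw [← hBrange, ← MonoidHom.range_comp, hcomp, MonoidHom.range_comp,
        MonoidHom.range_eq_top.2 ε.surjective, ← MonoidHom.range_eq_map]
    rw [hV, Subgroup.map_normalClosure _ _ (D.trans Θ).surjective,
      Subgroup.map_normalClosure _ _ θ₀.surjective, hDB, hEB]

end Rebasing

end Literature.GroupTheory.CombinatorialGroupTheory
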